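import Mathlib
import Summits.Ventures.PercRepro2.HCov
import Summits.Ventures.PercRepro2.RootLeafUSigns
import Summits.Ventures.PercRepro2.RootLeafUMixK
import Summits.Ventures.PercRepro2.RootLeafUCoin3Outside
import Summits.Ventures.PercRepro2.RootLeafUThreshold
import Summits.Ventures.PercRepro2.RootLeafUThresholdPD
import Summits.Ventures.PercRepro2.BHKOutside
import Summits.Ventures.PercRepro2.ExploreA3

/-!
# (G4-u): the `o ∈ K` half of W1 from the `PD`-share bound on the `b`-covariance
(blind cell PercRepro2, p4 g18; S3 (G4-u) item (ae), proofs/P4-G18-PDTHRESHOLD.md §3)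

Conventions of RootLeafUMixK: `P₀·T2oK = A·ℋ′ + 2β·X_b + ℰ·(e0·P₀ − d0·P_o)` with
`ℋ′ = t′·P(PD,oK) − D·P(T′,oK) ≥ 0` and the `b`-covariance
`X_b = P(T′,bK,oK)·P₀ − P(T′,bK)·P_o − [P(PD,bL,oK) + P(T′,bL,oK)]·P₀ + [P(PD,bL) + P(T′,bL)]·P_o`.

**`T2oK_nonneg_of_XbPD`**: the single inequality

  **(XB-PD)**  `−ℋ′·P(PD, bK) ≤ D·X_b`,  i.e. `X_b ≥ −ℋ′·P(bK | PD)`,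

implies `0 ≤ T2oK`.  Proof: `D·(A·ℋ′ + 2β·X_b) ≥ ℋ′·(A·D − 2β·P(PD,bK)) ≥ 0` by the `PD`-threshold
`ThresholdPD.A_mul_D_ge` and `ℋ′ ≥ 0`; for `D > 0` this is (MIX-K) and `MixK.T2oK_nonneg_of_mixK`
closes; for `D = 0` every `PD`-mass vanishes, `ℋ′ = 0`, and `X_b = P₀²·[Cov'(bK, oK) − Cov'(bL, oK)]`
is non-negative by BHK06 1.3 (`bhk_univ_avoid`: `b ∈ K`, `o ∈ K` positively correlated given `K`
avoids `{u, c}`) and BHK06 1.4 (`bhk_cross_cluster_avoid`: `b ∈ L` against `o ∈ K`).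

(XB-PD) is FALSE in general (it is the candidate (C-PD) of S3 (aa)(9)); on every boundary-`{u, a₂, c}`
pocket it holds with room — there the `K`-exploration identity gives
`D·X_b = ℋ′·(P(PD, b ↔ c) − P(PD, bK))` exactly (paper §2), so the `o ∈ K` half of W1 on the whole
pocket class is this theorem plus the pocket identity.
-/

namespace Summit.Ventures.PercRepro2

open UnionCluster CovForm

namespace RootLeafU

namespace XbPD

variable {V : Type*} {E : Type*} [Fintype E] [DecidableEq E] [Fintype V] [DecidableEq V]
  {R : Type*} [Field R] [LinearOrder R] [IsStrictOrderedRing R]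

variable (p : E → R) (ends : E → Sym2 V) (o a₂ c b u : V)

omit [Fintype E] [DecidableEq E] [Fintype V] in
/-- `{a₂ ↮ u, a₂ ↮ c} = Q ∩ {c ∉ K}`. -/
lemma avoidAll_pair_eq : avoidAll ends a₂ {u, c} = avoidAll ends a₂ {u} ∩ (connEvent ends a₂ c)ᶜ := by
  ext ω
  simp only [mem_avoidAll, Finset.mem_insert, Finset.mem_singleton, forall_eq_or_imp, forall_eq,
    Set.mem_inter_iff, Set.mem_compl_iff, mem_connEvent]

/-- BHK06 1.3 in the world `K` avoids `{u, c}`: `P(P₀, bK)·P(P₀, oK) ≤ P(P₀, bK, oK)·P₀`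
(`P₀ = Q ∩ {c ∉ K}`). -/
lemma bK_oK_pos (hp : IsProbVec p) :
    prob p (avoidAll ends a₂ {u, c} ∩ connEvent ends a₂ b) *
        prob p (avoidAll ends a₂ {u, c} ∩ connEvent ends a₂ o) ≤
      prob p (avoidAll ends a₂ {u, c} ∩ (connEvent ends a₂ b ∩ connEvent ends a₂ o)) *
        prob p (avoidAll ends a₂ {u, c}) := by
  classical
  have key := bhk_univ_avoid p hp ends a₂ ({u, c} : Finset V)
    (monotone_indicator_one_of_isUpperSet (R := R) (isUpperSet_mem_setOf b))
    (monotone_indicator_one_of_isUpperSet (R := R) (isUpperSet_mem_setOf o))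
    (fun _ => Set.indicator_apply_nonneg fun _ => zero_le_one)
    (fun _ => Set.indicator_apply_nonneg fun _ => zero_le_one)
  rw [← prob_clusterInEvent_inter_eq_expect, ← prob_clusterInEvent_inter_eq_expect] at key
  have e : (fun ω => ({W : Set V | b ∈ W} : Set (Set V)).indicator (1 : Set V → R) (cluster ends ω a₂) *
      ({W : Set V | o ∈ W} : Set (Set V)).indicator 1 (cluster ends ω a₂) *
      (avoidAll ends a₂ {u, c}).indicator 1 ω) =
      fun ω => (({W : Set V | b ∈ W} : Set (Set V)) ∩ {W : Set V | o ∈ W}).indicator 1 (cluster ends ω a₂) *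
        (avoidAll ends a₂ {u, c}).indicator 1 ω := by
    funext ω
    by_cases h1 : cluster ends ω a₂ ∈ ({W : Set V | b ∈ W} : Set (Set V)) <;>
      by_cases h2 : cluster ends ω a₂ ∈ ({W : Set V | o ∈ W} : Set (Set V)) <;> simp [h1, h2]
  rw [e, ← prob_clusterInEvent_inter_eq_expect] at key
  have e2 : clusterInEvent ends a₂ (({W : Set V | b ∈ W} : Set (Set V)) ∩ {W : Set V | o ∈ W}) =
      connEvent ends a₂ b ∩ connEvent ends a₂ o := ExploreA3.clusterInEvent_mem_inter_eq ends a₂ b o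
  rw [e2, ExploreA3.clusterInEvent_mem_eq, ExploreA3.clusterInEvent_mem_eq, Set.inter_comm _ (avoidAll ends a₂ {u, c}),
    Set.inter_comm _ (avoidAll ends a₂ {u, c}), Set.inter_comm _ (avoidAll ends a₂ {u, c})] at key
  exact key

/-- BHK06 1.4 in the world `K` avoids `{u, c}`: `P(P₀, oK, bL)·P₀ ≤ P(P₀, oK)·P(P₀, bL)`. -/
lemma oK_bL_neg (hp : IsProbVec p) :
    prob p (avoidAll ends a₂ {u, c} ∩ (connEvent ends a₂ o ∩ connEvent ends u b)) *
        prob p (avoidAll ends a₂ {u, c}) ≤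
      prob p (avoidAll ends a₂ {u, c} ∩ connEvent ends a₂ o) *
        prob p (avoidAll ends a₂ {u, c} ∩ connEvent ends u b) := by
  classical
  have h := bhk_cross_cluster_avoid p hp ends a₂ u (X := {u, c}) (by simp)
    (isUpperSet_mem_setOf o) (isUpperSet_mem_setOf b)
  rw [ExploreA3.clusterInEvent_mem_eq, ExploreA3.clusterInEvent_mem_eq] at h
  have e1 : connEvent ends a₂ o ∩ connEvent ends u b ∩ avoidAll ends a₂ {u, c} =
      avoidAll ends a₂ {u, c} ∩ (connEvent ends a₂ o ∩ connEvent ends u b) := Set.inter_comm _ _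
  have e2 : connEvent ends a₂ o ∩ avoidAll ends a₂ {u, c} = avoidAll ends a₂ {u, c} ∩ connEvent ends a₂ o :=
    Set.inter_comm _ _
  have e3 : connEvent ends u b ∩ avoidAll ends a₂ {u, c} = avoidAll ends a₂ {u, c} ∩ connEvent ends u b :=
    Set.inter_comm _ _
  rw [e1, e2, e3] at h
  exact h

/-- **`0 ≤ T2oK` from (XB-PD)**: if `−ℋ′·P(PD, bK) ≤ D·X_b` then the `o ∈ K` half of W1 holds
(`ℋ′`, `X_b`, `A`, `β` written out as in `MixK.P0_mul_T2oK_eq`). -/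
theorem T2oK_nonneg_of_XbPD (hp : IsProbVec p)
    (hX : -((prob p (TEvent ends a₂ u c) * prob p (PDEvent ends u a₂ c ∩ connEvent ends a₂ o) - prob p (PDEvent ends u a₂ c) * prob p (TEvent ends a₂ u c ∩ connEvent ends a₂ o)) * prob p (PDEvent ends u a₂ c ∩ connEvent ends a₂ b)) ≤
      prob p (PDEvent ends u a₂ c) * (prob p (TEvent ends a₂ u c ∩ (connEvent ends a₂ o ∩ connEvent ends a₂ b)) * (prob p (PDEvent ends u a₂ c) + prob p (TEvent ends a₂ u c)) - prob p (TEvent ends a₂ u c ∩ connEvent ends a₂ b) * (prob p (PDEvent ends u a₂ c ∩ connEvent ends a₂ o) + prob p (TEvent ends a₂ u c ∩ connEvent ends a₂ o)) - (prob p (PDEvent ends u a₂ c ∩ (connEvent ends a₂ o ∩ connEvent ends u b)) + prob p (TEvent ends a₂ u c ∩ (connEvent ends a₂ o ∩ connEvent ends u b))) * (prob p (PDEvent ends u a₂ c) + prob p (TEvent ends a₂ u c)) + (prob p (PDEvent ends u a₂ c ∩ connEvent ends u b) + prob p (TEvent ends a₂ u c ∩ connEvent ends u b)) * (prob p (PDEvent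 ends u a₂ c ∩ connEvent ends a₂ o) + prob p (TEvent ends a₂ u c ∩ connEvent ends a₂ o)))) :
    0 ≤ T2oK p ends o a₂ c b u := by
  have hH := MixK.HoK_nonneg p ends o a₂ c u hp
  have hTh := ThresholdPD.A_mul_D_ge p ends a₂ c b u hp
  have hD := prob_nonneg hp (PDEvent ends u a₂ c)
  have hβ : 0 ≤ prob p Set.univ * prob p (PDEvent ends u a₂ c) + prob p (avoidAll ends a₂ {c}) * prob p (avoidAll ends a₂ {u}) := by
    have := prob_nonneg hp (avoidAll ends a₂ {c})
    have := prob_nonneg hp (avoidAll ends a₂ {u})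
    rw [prob_univ]
    nlinarith
  rcases hD.lt_or_eq with hpos | hzero
  · -- `D > 0`: `D · (MIX-K) ≥ ℋ′ · (A·D − 2β·P(PD,bK)) ≥ 0`
    apply MixK.T2oK_nonneg_of_mixK p ends o a₂ c b u hp
    have key : 0 ≤ prob p (PDEvent ends u a₂ c) * (((prob p (PDEvent ends u a₂ c) * prob p (connEvent ends a₂ b) + prob p (avoidAll ends a₂ {c}) * gap p ends u a₂ b) + (prob p Set.univ * EQb3 p ends u a₂ c b + prob p Set.univ * PDb p ends u a₂ c b + prob p (connEvent ends a₂ b) * EQ3 p ends u a₂ c + prob p (connEvent ends a₂ b) * prob p (avoidAll ends a₂ {u}) - (prob p Set.univ - prob p (avoidAll ends a₂ {c})) * gap p ends u a₂ b)) * (prob p (TEvent ends a₂ u c) * prob p (PDEvent ends u a₂ c ∩ connEvent ends a₂ o) - prob p (PDEvent ends u a₂ c) * prob p (TEvent ends a₂ u c ∩ connEvent ends a₂ o)) + 2 * (prob p Set.univ * prob p (PDEvent ends u a₂ c) + prob p (avoidAll ends a₂ {c}) * prob p (avoidAll ends a₂ {u})) * (prob p (TEvent ends a₂ u c ∩ (connEvent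 ends a₂ o ∩ connEvent ends a₂ b)) * (prob p (PDEvent ends u a₂ c) + prob p (TEvent ends a₂ u c)) - prob p (TEvent ends a₂ u c ∩ connEvent ends a₂ b) * (prob p (PDEvent ends u a₂ c ∩ connEvent ends a₂ o) + prob p (TEvent ends a₂ u c ∩ connEvent ends a₂ o)) - (prob p (PDEvent ends u a₂ c ∩ (connEvent ends a₂ o ∩ connEvent ends u b)) + prob p (TEvent ends a₂ u c ∩ (connEvent ends a₂ o ∩ connEvent ends u b))) * (prob p (PDEvent ends u a₂ c) + prob p (TEvent ends a₂ u c)) + (prob p (PDEvent ends u a₂ c ∩ connEvent ends u b) + prob p (TEvent ends a₂ u c ∩ connEvent ends u b)) * (prob p (PDEvent ends u a₂ c ∩ connEvent ends a₂ o) + prob p (TEvent ends a₂ u c ∩ connEvent ends a₂ o)))) := by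
      have t1 := mul_nonneg hH (sub_nonneg.mpr hTh)
      have t2 := mul_nonneg hβ (sub_nonneg.mpr hX)
      nlinarith [t1, t2]
    exact nonneg_of_mul_nonneg_right key hpos
  · -- `D = 0`: the `PD`-masses vanish, `ℋ′ = 0`, and `X_b ≥ 0` by BHK 1.3 / 1.4 in the `P₀` world
    have hz := hzero.symm
    have hPD : ∀ X : Set (Config E), prob p (PDEvent ends u a₂ c ∩ X) = 0 := by
      intro X
      have h1 := prob_inter_le_left hp (PDEvent ends u a₂ c) X
      have h2 := prob_nonneg hp (PDEvent ends u a₂ c ∩ X)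
      linarith
    apply MixK.T2oK_nonneg_of_mixK p ends o a₂ c b u hp
    have hbK := bK_oK_pos p ends o a₂ c b u hp
    have hbL := oK_bL_neg p ends o a₂ c b u hp
    have eP0 := MixK.P0_eq p ends a₂ c u
    have ePo := MixK.Po_eq p ends o a₂ c u
    have e1 := MixK.prob_PD_add_Tp p ends a₂ c u (connEvent ends a₂ b)
    have e2 := MixK.prob_PD_add_Tp p ends a₂ c u (connEvent ends u b)
    have e3 := MixK.prob_PD_add_Tp p ends a₂ c u (connEvent ends a₂ o ∩ connEvent ends a₂ b)
    have e4 := MixK.prob_PD_add_Tp p ends a₂ c u (connEvent ends a₂ o ∩ connEvent ends u b)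
    rw [avoidAll_pair_eq] at hbK hbL
    have r1 : avoidAll ends a₂ {u} ∩ (connEvent ends a₂ c)ᶜ ∩ connEvent ends a₂ b =
        avoidAll ends a₂ {u} ∩ connEvent ends a₂ b ∩ (connEvent ends a₂ c)ᶜ := by
      rw [Set.inter_assoc, Set.inter_comm (connEvent ends a₂ c)ᶜ, ← Set.inter_assoc]
    have r2 : avoidAll ends a₂ {u} ∩ (connEvent ends a₂ c)ᶜ ∩ connEvent ends a₂ o =
        avoidAll ends a₂ {u} ∩ connEvent ends a₂ o ∩ (connEvent ends a₂ c)ᶜ := by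
      rw [Set.inter_assoc, Set.inter_comm (connEvent ends a₂ c)ᶜ, ← Set.inter_assoc]
    have r3 : avoidAll ends a₂ {u} ∩ (connEvent ends a₂ c)ᶜ ∩ (connEvent ends a₂ b ∩ connEvent ends a₂ o) =
        avoidAll ends a₂ {u} ∩ (connEvent ends a₂ o ∩ connEvent ends a₂ b) ∩ (connEvent ends a₂ c)ᶜ := by
      rw [Set.inter_comm (connEvent ends a₂ b), Set.inter_assoc, Set.inter_comm (connEvent ends a₂ c)ᶜ, ← Set.inter_assoc]
    have r4 : avoidAll ends a₂ {u} ∩ (connEvent ends a₂ c)ᶜ ∩ connEvent ends u b =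
        avoidAll ends a₂ {u} ∩ connEvent ends u b ∩ (connEvent ends a₂ c)ᶜ := by
      rw [Set.inter_assoc, Set.inter_comm (connEvent ends a₂ c)ᶜ, ← Set.inter_assoc]
    have r5 : avoidAll ends a₂ {u} ∩ (connEvent ends a₂ c)ᶜ ∩ (connEvent ends a₂ o ∩ connEvent ends u b) =
        avoidAll ends a₂ {u} ∩ (connEvent ends a₂ o ∩ connEvent ends u b) ∩ (connEvent ends a₂ c)ᶜ := by
      rw [Set.inter_assoc, Set.inter_comm (connEvent ends a₂ c)ᶜ, ← Set.inter_assoc]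
    rw [r1, r2, r3, ← eP0, ← ePo, ← e1, ← e3] at hbK
    rw [r2, r4, r5, ← eP0, ← ePo, ← e2, ← e4] at hbL
    simp only [hz, hPD, zero_add, zero_mul, mul_zero, sub_zero] at hbK hbL hβ ⊢
    have t1 := mul_nonneg hβ (sub_nonneg.mpr hbK)
    have t2 := mul_nonneg hβ (sub_nonneg.mpr hbL)
    nlinarith [t1, t2]

end XbPD

end RootLeafU

end Summit.Ventures.PercRepro2
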